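import Literature.MathematicalPhysics.QuantumFieldTheory.QCDSlabFunctional
import Literature.MathematicalPhysics.QuantumFieldTheory.YangMillsOS

/-!
# No-junk lemmas for the slab vocabulary of `spectral-requantisation-dock` (drefute gen 2)

`slabZ`, `lambda0`, `slabZeta` below are VERBATIM copies of the skeleton's definitions
(`Lines/spectral-requantisation-dock.lean`, namespace `…SpectralRequantisationDock`), re-declared here
because a `Lines/` work file is not an importable module.  Proved: the Wilson weight of the slab is
continuous and two-sided exponentially bounded, `slabZ > 0` with explicit two-sided bounds, and
`lambda0 ≥ exp(−2|β|·9·M_r·N³) > 0` (so `slabZeta = Z/λ₀^M` divides by a genuinely positive number: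
the `liminf` in `lambda0` is taken over a sequence bounded in `[e^{-a}, e^{a}]`).
-/

noncomputable section

open MeasureTheory Filter
open scoped Topology
open Literature.MathematicalPhysics.QuantumFieldTheory Literature.MathematicalPhysics.QuantumLattice

namespace Summit.QuantumFields.YangMills.Cruxes.ClusteringToYangMills.DrefuteGen2

variable {G : Type} [Group G] [TopologicalSpace G] [IsTopologicalGroup G] [CompactSpace G]
  [MeasurableSpace G] [BorelSpace G]

/-- Verbatim copy of the skeleton's `slabZ`. -/
def slabZ (r : LatticeRep G) (β : ℝ) (M N : ℕ) [NeZero M] [NeZero N] : ℝ :=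
  ∫ U, SlabGauge.weight r.ρ β β U ∂(SlabGauge.haar 3 M N G)

/-- Verbatim copy of the skeleton's `lambda0`. -/
def lambda0 (r : LatticeRep G) (β : ℝ) (N : ℕ) [NeZero N] : ℝ :=
  Filter.liminf (fun M : ℕ => (slabZ r β (M + 1) N) ^ (((M : ℝ) + 1)⁻¹)) atTop

/-- Verbatim copy of the skeleton's `slabZeta`. -/
def slabZeta (r : LatticeRep G) (β : ℝ) (M N : ℕ) [NeZero M] [NeZero N] : ℝ :=
  slabZ r β M N / (lambda0 r β N) ^ M

/-! ### A uniform bound on `Re tr ρ` -/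

omit [MeasurableSpace G] [BorelSpace G] [IsTopologicalGroup G] in
/-- `|Re tr ρ(g)| ≤ M_r` for a continuous representation of a compact group. -/
theorem exists_abs_re_trace_le (r : LatticeRep G) :
    ∃ Mr : ℝ, 0 ≤ Mr ∧ ∀ g : G, |(r.ρ g).trace.re| ≤ Mr := by
  have hcont : Continuous fun g : G => |(r.ρ g).trace.re| :=
    continuous_abs.comp (Complex.continuous_re.comp (r.continuous.matrix_trace))
  obtain ⟨C, hC⟩ := (isCompact_univ.image hcont).isBounded.bddAbove
  refine ⟨max C 0, le_max_right _ _, fun g => (le_max_left C 0).trans' ?_⟩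
  exact hC ⟨g, Set.mem_univ _, rfl⟩

/-- The crude plaquette count used in the bounds: `|sites| · d·d · M_r` (`d·d` dominates both `d`,
the temporal plaquettes per site, and `d(d-1)/2`, the spatial ones). -/
def actionBound (d' L₀' L' : ℕ) [NeZero L₀'] [NeZero L'] (Mr : ℝ) : ℝ :=
  (Fintype.card (SlabGauge.Site d' L₀' L') : ℝ) * ((d' : ℝ) * d') * Mr

/-! ### The slab weight: continuity and two-sided bounds -/

section Weight

variable {d L₀ L : ℕ} [NeZero L₀] [NeZero L]

omit [MeasurableSpace G] [BorelSpace G] [CompactSpace G] [NeZero L₀] [NeZero L] in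
/-- Plaquette holonomies of the slab depend continuously on the configuration. -/
theorem continuous_plaquette (x : SlabGauge.Site d L₀ L) (μ ν : SlabGauge.Dir d) :
    Continuous fun U : SlabGauge.Config d L₀ L G => SlabGauge.plaquette U x μ ν := by
  unfold SlabGauge.plaquette
  fun_prop

omit [MeasurableSpace G] [BorelSpace G] [CompactSpace G] in
/-- `minusAction` is continuous for a continuous representation. -/
theorem continuous_minusAction (r : LatticeRep G) (JE JM : ℝ) :
    Continuous fun U : SlabGauge.Config d L₀ L G => SlabGauge.minusAction r.ρ JE JM U := by
  unfold SlabGauge.minusAction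
  refine Continuous.add (continuous_const.mul ?_) (continuous_const.mul ?_)
  · refine continuous_finsetSum _ fun x _ => continuous_finsetSum _ fun i _ => ?_
    exact Complex.continuous_re.comp ((r.continuous.comp (continuous_plaquette x _ _)).matrix_trace)
  · refine continuous_finsetSum _ fun x _ => continuous_finsetSum _ fun p _ => ?_
    exact Complex.continuous_re.comp ((r.continuous.comp (continuous_plaquette x _ _)).matrix_trace)

omit [MeasurableSpace G] [BorelSpace G] [CompactSpace G] in
/-- The slab weight is continuous. -/
theorem continuous_weight (r : LatticeRep G) (JE JM : ℝ) :
    Continuous fun U : SlabGauge.Config d L₀ L G => SlabGauge.weight r.ρ JE JM U :=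
  Real.continuous_exp.comp (continuous_minusAction r JE JM)

omit [IsTopologicalGroup G] [CompactSpace G] [MeasurableSpace G] [BorelSpace G] in
/-- `|minusAction| ≤ (|J_E| + |J_M|) · |sites| · d² · M_r`. -/
theorem abs_minusAction_le (r : LatticeRep G) {Mr : ℝ} (hMr0 : 0 ≤ Mr)
    (hMr : ∀ g : G, |(r.ρ g).trace.re| ≤ Mr) (JE JM : ℝ) (U : SlabGauge.Config d L₀ L G) :
    |SlabGauge.minusAction r.ρ JE JM U| ≤ (|JE| + |JM|) * actionBound d L₀ L Mr := by
  unfold SlabGauge.minusAction actionBound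
  have hd : (Fintype.card (Fin d) : ℝ) ≤ (d : ℝ) * d := by
    rw [Fintype.card_fin]
    rcases Nat.eq_zero_or_pos d with h | h
    · simp [h]
    · have : (1 : ℝ) ≤ d := by exact_mod_cast h
      nlinarith
  have hp : (Fintype.card {p : Fin d × Fin d // p.1 < p.2} : ℝ) ≤ (d : ℝ) * d := by
    have h1 : Fintype.card {p : Fin d × Fin d // p.1 < p.2} ≤ Fintype.card (Fin d × Fin d) :=
      Fintype.card_subtype_le _
    rw [Fintype.card_prod, Fintype.card_fin] at h1
    exact_mod_cast h1
  -- the two sums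
  have hS1 : |∑ x : SlabGauge.Site d L₀ L, ∑ i : Fin d,
      (r.ρ (SlabGauge.plaquette U x none (some i))).trace.re| ≤
      (Fintype.card (SlabGauge.Site d L₀ L) : ℝ) * ((d : ℝ) * d) * Mr := by
    refine (Finset.abs_sum_le_sum_abs _ _).trans ?_
    have : ∀ x ∈ (Finset.univ : Finset (SlabGauge.Site d L₀ L)),
        |∑ i : Fin d, (r.ρ (SlabGauge.plaquette U x none (some i))).trace.re| ≤ (d : ℝ) * d * Mr := by
      intro x _
      refine (Finset.abs_sum_le_sum_abs _ _).trans ?_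
      refine (Finset.sum_le_sum fun i _ => hMr _).trans ?_
      rw [Finset.sum_const, Finset.card_univ, nsmul_eq_mul]
      exact mul_le_mul_of_nonneg_right hd hMr0
    refine (Finset.sum_le_sum this).trans ?_
    rw [Finset.sum_const, Finset.card_univ, nsmul_eq_mul]
    ring_nf
    rfl
  have hS2 : |∑ x : SlabGauge.Site d L₀ L, ∑ p : {p : Fin d × Fin d // p.1 < p.2},
      (r.ρ (SlabGauge.plaquette U x (some p.1.1) (some p.1.2))).trace.re| ≤
      (Fintype.card (SlabGauge.Site d L₀ L) : ℝ) * ((d : ℝ) * d) * Mr := by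
    refine (Finset.abs_sum_le_sum_abs _ _).trans ?_
    have : ∀ x ∈ (Finset.univ : Finset (SlabGauge.Site d L₀ L)),
        |∑ p : {p : Fin d × Fin d // p.1 < p.2},
          (r.ρ (SlabGauge.plaquette U x (some p.1.1) (some p.1.2))).trace.re| ≤ (d : ℝ) * d * Mr := by
      intro x _
      refine (Finset.abs_sum_le_sum_abs _ _).trans ?_
      refine (Finset.sum_le_sum fun p _ => hMr _).trans ?_
      rw [Finset.sum_const, Finset.card_univ, nsmul_eq_mul]
      exact mul_le_mul_of_nonneg_right hp hMr0
    refine (Finset.sum_le_sum this).trans ?_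
    rw [Finset.sum_const, Finset.card_univ, nsmul_eq_mul]
    ring_nf
    rfl
  set S1 := ∑ x : SlabGauge.Site d L₀ L, ∑ i : Fin d,
      (r.ρ (SlabGauge.plaquette U x none (some i))).trace.re
  set S2 := ∑ x : SlabGauge.Site d L₀ L, ∑ p : {p : Fin d × Fin d // p.1 < p.2},
      (r.ρ (SlabGauge.plaquette U x (some p.1.1) (some p.1.2))).trace.re
  set B := (Fintype.card (SlabGauge.Site d L₀ L) : ℝ) * ((d : ℝ) * d) * Mr
  have hB : 0 ≤ B := by positivity
  calc |JE * S1 + JM * S2| ≤ |JE * S1| + |JM * S2| := abs_add_le _ _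
    _ = |JE| * |S1| + |JM| * |S2| := by rw [abs_mul, abs_mul]
    _ ≤ |JE| * B + |JM| * B := add_le_add (mul_le_mul_of_nonneg_left hS1 (abs_nonneg _))
        (mul_le_mul_of_nonneg_left hS2 (abs_nonneg _))
    _ = (|JE| + |JM|) * B := by ring

omit [IsTopologicalGroup G] [CompactSpace G] [MeasurableSpace G] [BorelSpace G] in
/-- Two-sided bound on the slab weight: `e^{-(|J_E|+|J_M|) B} ≤ weight ≤ e^{(|J_E|+|J_M|) B}`. -/
theorem weight_mem_Icc (r : LatticeRep G) {Mr : ℝ} (hMr0 : 0 ≤ Mr)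
    (hMr : ∀ g : G, |(r.ρ g).trace.re| ≤ Mr) (JE JM : ℝ) (U : SlabGauge.Config d L₀ L G) :
    Real.exp (-((|JE| + |JM|) * actionBound d L₀ L Mr)) ≤ SlabGauge.weight r.ρ JE JM U ∧
      SlabGauge.weight r.ρ JE JM U ≤ Real.exp ((|JE| + |JM|) * actionBound d L₀ L Mr) := by
  have h := abs_le.1 (abs_minusAction_le r hMr0 hMr JE JM U)
  exact ⟨Real.exp_le_exp.2 h.1, Real.exp_le_exp.2 h.2⟩

end Weight

/-! ### `slabZ > 0` with explicit bounds, and `lambda0 > 0` -/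

section Z

omit [IsTopologicalGroup G] [MeasurableSpace G] [BorelSpace G] in
/-- Second countability of `G` from the faithful matrix representation (as in `LatticeRep.curvature`). -/
theorem secondCountable_of_rep (r : LatticeRep G) : SecondCountableTopology G :=
  (r.continuous.isClosedEmbedding r.injective).isEmbedding.secondCountableTopology

/-- Two-sided bounds on the slab partition function. -/
theorem slabZ_mem_Icc (r : LatticeRep G) {Mr : ℝ} (hMr0 : 0 ≤ Mr)
    (hMr : ∀ g : G, |(r.ρ g).trace.re| ≤ Mr) (β : ℝ) (M N : ℕ) [NeZero M] [NeZero N] :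
    Real.exp (-((|β| + |β|) * actionBound 3 M N Mr)) ≤ slabZ r β M N ∧
      slabZ r β M N ≤ Real.exp ((|β| + |β|) * actionBound 3 M N Mr) := by
  haveI : SecondCountableTopology G := secondCountable_of_rep r
  set lo := Real.exp (-((|β| + |β|) * actionBound 3 M N Mr))
  set hi := Real.exp ((|β| + |β|) * actionBound 3 M N Mr)
  have hw : ∀ U, lo ≤ SlabGauge.weight r.ρ β β U ∧ SlabGauge.weight r.ρ β β U ≤ hi :=
    fun U => weight_mem_Icc r hMr0 hMr β β U
  have hmeas : AEStronglyMeasurable (fun U : SlabGauge.Config 3 M N G => SlabGauge.weight r.ρ β β U)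
      (SlabGauge.haar 3 M N G) :=
    (continuous_weight r β β).measurable.aestronglyMeasurable
  have hint : Integrable (fun U : SlabGauge.Config 3 M N G => SlabGauge.weight r.ρ β β U)
      (SlabGauge.haar 3 M N G) := by
    refine Integrable.mono' (integrable_const hi) hmeas (Eventually.of_forall fun U => ?_)
    rw [Real.norm_eq_abs, abs_of_pos (SlabGauge.weight_pos r.ρ β β U)]
    exact (hw U).2
  constructor
  · calc lo = ∫ _U, lo ∂(SlabGauge.haar 3 M N G) := by simp
      _ ≤ slabZ r β M N := integral_mono (integrable_const lo) hint fun U => (hw U).1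
  · calc slabZ r β M N ≤ ∫ _U, hi ∂(SlabGauge.haar 3 M N G) :=
          integral_mono hint (integrable_const hi) fun U => (hw U).2
      _ = hi := by simp

/-- The slab partition function is positive. -/
theorem slabZ_pos (r : LatticeRep G) (β : ℝ) (M N : ℕ) [NeZero M] [NeZero N] : 0 < slabZ r β M N := by
  obtain ⟨Mr, hMr0, hMr⟩ := exists_abs_re_trace_le r
  exact (Real.exp_pos _).trans_le (slabZ_mem_Icc r hMr0 hMr β M N).1

/-- The slab has `M · N³` sites. -/
theorem card_site (M N : ℕ) [NeZero M] [NeZero N] :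
    Fintype.card (SlabGauge.Site 3 M N) = M * N ^ 3 := by
  simp [SlabGauge.Site, Fintype.card_prod, ZMod.card]

/-- The per-time-slice exponent `a = 2|β| · 9 · M_r · N³`. -/
def sliceExp (β Mr : ℝ) (N : ℕ) : ℝ := (|β| + |β|) * ((N : ℝ) ^ 3 * ((3 : ℝ) * 3) * Mr)

theorem actionBound_eq (Mr : ℝ) (M N : ℕ) [NeZero M] [NeZero N] (β : ℝ) :
    (|β| + |β|) * actionBound 3 M N Mr = (M : ℝ) * sliceExp β Mr N := by
  unfold actionBound sliceExp
  rw [card_site]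
  push_cast
  ring

/-- `Z((M+1) × N³)^{1/(M+1)} ≥ e^{-a}` for every `M`. -/
theorem exp_neg_le_slabZ_rpow (r : LatticeRep G) {Mr : ℝ} (hMr0 : 0 ≤ Mr)
    (hMr : ∀ g : G, |(r.ρ g).trace.re| ≤ Mr) (β : ℝ) (N : ℕ) [NeZero N] (M : ℕ) :
    Real.exp (-sliceExp β Mr N) ≤ (slabZ r β (M + 1) N) ^ (((M : ℝ) + 1)⁻¹) := by
  have hlo := (slabZ_mem_Icc r hMr0 hMr β (M + 1) N).1
  rw [actionBound_eq] at hlo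
  have hM : (0 : ℝ) < (M : ℝ) + 1 := by positivity
  have hexp : Real.exp (-sliceExp β Mr N) =
      (Real.exp (-(((M + 1 : ℕ) : ℝ) * sliceExp β Mr N))) ^ (((M : ℝ) + 1)⁻¹) := by
    rw [← Real.exp_mul]
    congr 1
    push_cast
    field_simp
  rw [hexp]
  exact Real.rpow_le_rpow (Real.exp_pos _).le hlo (inv_nonneg.2 hM.le)

/-- `Z((M+1) × N³)^{1/(M+1)} ≤ e^{a}` for every `M` (so the `liminf` defining `lambda0` is genuine). -/
theorem slabZ_rpow_le_exp (r : LatticeRep G) {Mr : ℝ} (hMr0 : 0 ≤ Mr)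
    (hMr : ∀ g : G, |(r.ρ g).trace.re| ≤ Mr) (β : ℝ) (N : ℕ) [NeZero N] (M : ℕ) :
    (slabZ r β (M + 1) N) ^ (((M : ℝ) + 1)⁻¹) ≤ Real.exp (sliceExp β Mr N) := by
  have hhi := (slabZ_mem_Icc r hMr0 hMr β (M + 1) N).2
  rw [actionBound_eq] at hhi
  have hM : (0 : ℝ) < (M : ℝ) + 1 := by positivity
  have hexp : Real.exp (sliceExp β Mr N) =
      (Real.exp (((M + 1 : ℕ) : ℝ) * sliceExp β Mr N)) ^ (((M : ℝ) + 1)⁻¹) := by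
    rw [← Real.exp_mul]
    congr 1
    push_cast
    field_simp
  rw [hexp]
  exact Real.rpow_le_rpow (slabZ_pos r β (M + 1) N).le hhi (inv_nonneg.2 hM.le)

/-- `lambda0 ≥ e^{-a} > 0`: the top eigenvalue of the slab transfer matrix, defined operator-free as a
`liminf`, is a positive real number. -/
theorem exp_neg_le_lambda0 (r : LatticeRep G) {Mr : ℝ} (hMr0 : 0 ≤ Mr)
    (hMr : ∀ g : G, |(r.ρ g).trace.re| ≤ Mr) (β : ℝ) (N : ℕ) [NeZero N] :
    Real.exp (-sliceExp β Mr N) ≤ lambda0 r β N := by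
  unfold lambda0
  refine le_liminf_of_le (isCoboundedUnder_ge_of_le atTop fun M => slabZ_rpow_le_exp r hMr0 hMr β N M) ?_
  exact Eventually.of_forall fun M => exp_neg_le_slabZ_rpow r hMr0 hMr β N M

/-- `lambda0 > 0`. -/
theorem lambda0_pos (r : LatticeRep G) (β : ℝ) (N : ℕ) [NeZero N] : 0 < lambda0 r β N := by
  obtain ⟨Mr, hMr0, hMr⟩ := exists_abs_re_trace_le r
  exact (Real.exp_pos _).trans_le (exp_neg_le_lambda0 r hMr0 hMr β N)

/-- `lambda0 ≤ e^{a}`. -/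
theorem lambda0_le_exp (r : LatticeRep G) {Mr : ℝ} (hMr0 : 0 ≤ Mr)
    (hMr : ∀ g : G, |(r.ρ g).trace.re| ≤ Mr) (β : ℝ) (N : ℕ) [NeZero N] :
    lambda0 r β N ≤ Real.exp (sliceExp β Mr N) := by
  unfold lambda0
  refine liminf_le_of_frequently_le (Eventually.of_forall fun M => slabZ_rpow_le_exp r hMr0 hMr β N M).frequently
    (isBoundedUnder_of ⟨Real.exp (-sliceExp β Mr N), fun M => exp_neg_le_slabZ_rpow r hMr0 hMr β N M⟩)

/-- `slabZeta` divides by a positive number (no `x / 0` junk) and is itself positive. -/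
theorem slabZeta_pos (r : LatticeRep G) (β : ℝ) (M N : ℕ) [NeZero M] [NeZero N] :
    0 < slabZeta r β M N :=
  div_pos (slabZ_pos r β M N) (pow_pos (lambda0_pos r β N) M)

end Z

end Summit.QuantumFields.YangMills.Cruxes.ClusteringToYangMills.DrefuteGen2

end
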